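import Mathlib
import HarnessLib
import Literature.RepresentationTheory.CompactGroups.WeylIntegralFormula
import Summits.Ventures.LatticeQCDFlow.Exactness.VandermondeIdentityDegenerate
import Summits.Ventures.LatticeQCDFlow.Exactness.SpectralKernelJacobianWeylShapeSU
import Summits.Ventures.LatticeQCDFlow.Exactness.SU3SpectralCouplingLayerUnconditional
import Summits.Ventures.LatticeQCDFlow.Exactness.SpectralTorusBasics
import Summits.Ventures.LatticeQCDFlow.Exactness.SpectralTorusMapMeasurable

/-!
# The booked density of the `SU(3)` spectral kernel: the torus density and Boyda's identity are DISCHARGED from "`J` is a function of the spectrum which, on the alcove chart, is `JA · |Δ(e^{ix(Gθ)})|² / |Δ(e^{ix(θ)})|²`"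

HONEST FRAMING: exact (Metropolis-corrected) sampling algorithms for lattice gauge theory;
figures of merit are autocorrelation/cost numbers at stated couplings and volumes; no
continuum-physics claim.

Venture `LatticeQCDFlow` (cell pub-lqcd), topic `Exactness`; FANOUT row 10 (`eng-equiv`, engine
`latflow.equiv` `spectral.spectral_kernel`, `N = 3`: `ldj = ld_chi + ld_phi_out − ld_phi_in +
log_haar(x') − log_haar(x)`, `log_haar(x) = log |Δ(e^{ix})|²`, computed from the eigen-phases alone;
Boyda et al., PRD 103 (2021) 074504, App. B Algorithm 2 step 10).  NEW WORK of the cell: the `N = 3`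
analogue of `SU2SpectralKernelBookedDensity.lean` — the bookkeeping hypotheses of
`hasJacobian_spectralKernel_su3_of_alcoveMap` (torus density, Weyl invariance, Boyda's identity) are
CONSTRUCTED / PROVED from: `J` is a symmetric measurable function of the spectrum with the booked
value on the alcove chart, and `G` maps the open alcove into itself.  Nothing is cited as a fact;
no number; no definition.

## What is typed (`D(d) = (∏_i ∏_{j≠i} ‖d_i − d_j‖)/3!`, `A = {θ₀ < θ₁ < −θ₀−θ₁ < θ₀ + 2π}`)

* `angleChart_su3_regular` (on the alcove the chart point has pairwise distinct entries);
  **`exists_permDiag_angleChart_of_regular_su3`** (every REGULAR `t ∈ SΔ(3)` is `P σ (E θ)` with `θ ∈ A`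
  — Algorithm 1 on the torus);
* **`exists_torusDensity_su3_booked`** — for `f` measurable on the unimodular torus,
  permutation-equivariant and given on the alcove by `G` (`G(A) ⊆ A`) with torus map `fT`, and ANY
  `J : SU(3) → ℝ≥0∞` that is a symmetric measurable function `JD` of the spectrum with the alcove
  identity above: a measurable Weyl-invariant torus density `Jf` with `Jf ∘ E = JA` on `A` and Boyda's
  identity for all `(g, t)` EXISTS.

NOT here: the kernel / layer corollaries (`SU3SpectralCouplingLayerBooked.lean`); the elimination of
`fT`; `N ≥ 4`; any number.
-/

noncomputable section

namespace Summit.Ventures.LatticeQCDFlow.Exactness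

open MeasureTheory Matrix Set Real
open Literature.LinearAlgebra.Matrix
open Literature.MathematicalPhysics.QuantumFieldTheory (haarProbability)
open Literature.RepresentationTheory.CompactGroups
open scoped ENNReal

section Chart

variable {E : (Fin 2 → ℝ) → specialDiagonalTorus (Fin 3)}
  (hE : ∀ θ (i : Fin 3), (((E θ : specialDiagonalTorus (Fin 3)) : Matrix.specialUnitaryGroup (Fin 3) ℂ) :
    Matrix (Fin 3) (Fin 3) ℂ) i i = (Circle.exp ((![θ 0, θ 1, -(θ 0 + θ 1)] : Fin 3 → ℝ) i) : ℂ))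

include hE

/-- **On the alcove the chart point is regular**: for `θ ∈ A` the entries `e^{i x(θ)_i}` are pairwise
distinct (the phase differences lie in `(−2π, 2π) ∖ {0}`). -/
theorem angleChart_su3_regular {θ : Fin 2 → ℝ} (h0 : θ 0 < θ 1) (h1 : θ 1 < -(θ 0 + θ 1))
    (h2 : -(θ 0 + θ 1) < θ 0 + 2 * π) (i j : Fin 3) (hij : i ≠ j) :
    (((E θ : specialDiagonalTorus (Fin 3)) : Matrix.specialUnitaryGroup (Fin 3) ℂ) : Matrix (Fin 3) (Fin 3) ℂ) i i ≠
      (((E θ : specialDiagonalTorus (Fin 3)) : Matrix.specialUnitaryGroup (Fin 3) ℂ) : Matrix (Fin 3) (Fin 3) ℂ) j j := by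
  rw [hE, hE]
  intro h
  have h' := Circle.exp_eq_exp.mp (Subtype.ext h)
  obtain ⟨m, hm⟩ := h'
  have h0' : (![θ 0, θ 1, -(θ 0 + θ 1)] : Fin 3 → ℝ) ((1 : Equiv.Perm (Fin 3)) 0) <
      (![θ 0, θ 1, -(θ 0 + θ 1)] : Fin 3 → ℝ) ((1 : Equiv.Perm (Fin 3)) 1) := by simpa using h0
  have h1' : (![θ 0, θ 1, -(θ 0 + θ 1)] : Fin 3 → ℝ) ((1 : Equiv.Perm (Fin 3)) 1) <
      (![θ 0, θ 1, -(θ 0 + θ 1)] : Fin 3 → ℝ) ((1 : Equiv.Perm (Fin 3)) 2) := by simpa using h1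
  have h2' : (![θ 0, θ 1, -(θ 0 + θ 1)] : Fin 3 → ℝ) ((1 : Equiv.Perm (Fin 3)) 2) <
      (![θ 0, θ 1, -(θ 0 + θ 1)] : Fin 3 → ℝ) ((1 : Equiv.Perm (Fin 3)) 0) + 2 * π := by simpa using h2
  have hlt := abs_sub_lt_of_alcoveChain h0' h1' h2' i j
  have hne := injective_of_alcoveChain h0' h1'
  rw [hm, add_sub_cancel_left, abs_mul, abs_of_pos (by positivity : (0 : ℝ) < 2 * π)] at hlt
  have hm1 : |(m : ℝ)| < 1 := by
    by_contra hge
    push Not at hge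
    have : (1 : ℝ) * (2 * π) ≤ |(m : ℝ)| * (2 * π) := mul_le_mul_of_nonneg_right hge (by positivity)
    linarith
  have hm0 : m = 0 := by
    have : |m| < 1 := by exact_mod_cast hm1
    exact Int.abs_lt_one_iff.mp this
  rw [hm0, Int.cast_zero, zero_mul, add_zero] at hm
  exact hij (hne hm)

variable {P : Equiv.Perm (Fin 3) → specialDiagonalTorus (Fin 3) → specialDiagonalTorus (Fin 3)}
  (hP : ∀ σ t i,
    (((P σ t : specialDiagonalTorus (Fin 3)) : Matrix.specialUnitaryGroup (Fin 3) ℂ) : Matrix (Fin 3) (Fin 3) ℂ) i i =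
      ((t : Matrix.specialUnitaryGroup (Fin 3) ℂ) : Matrix (Fin 3) (Fin 3) ℂ) (σ i) (σ i))

include hP

/-- **Every regular point of `SΔ(3)` is a Weyl image of an alcove chart point**: if the diagonal
entries of `t` are pairwise distinct, then `t = P σ (E θ)` for some `σ ∈ S₃` and `θ ∈ A` — Algorithm 1
(`exists_intMul_add_mem_chamber_su3`) read on the torus. -/
theorem exists_permDiag_angleChart_of_regular_su3 {t : specialDiagonalTorus (Fin 3)}
    (hreg : ∀ i j, i ≠ j → ((t : Matrix.specialUnitaryGroup (Fin 3) ℂ) : Matrix (Fin 3) (Fin 3) ℂ) i i ≠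
      ((t : Matrix.specialUnitaryGroup (Fin 3) ℂ) : Matrix (Fin 3) (Fin 3) ℂ) j j) :
    ∃ (σ : Equiv.Perm (Fin 3)) (θ : Fin 2 → ℝ), (θ 0 < θ 1 ∧ θ 1 < -(θ 0 + θ 1) ∧ -(θ 0 + θ 1) < θ 0 + 2 * π) ∧
      t = P σ (E θ) := by
  -- the free arguments of `t`
  have hd1 : ∀ i, ‖((t : Matrix.specialUnitaryGroup (Fin 3) ℂ) : Matrix (Fin 3) (Fin 3) ℂ) i i‖ = 1 :=
    norm_specialDiagonalTorus_apply t
  have hprod : ((t : Matrix.specialUnitaryGroup (Fin 3) ℂ) : Matrix (Fin 3) (Fin 3) ℂ) 0 0 *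
      ((t : Matrix.specialUnitaryGroup (Fin 3) ℂ) : Matrix (Fin 3) (Fin 3) ℂ) 1 1 *
        ((t : Matrix.specialUnitaryGroup (Fin 3) ℂ) : Matrix (Fin 3) (Fin 3) ℂ) 2 2 = 1 := by
    have h := (norm_eq_one_and_prod_eq_one_of_mem_specialDiagonalTorus (coe_specialDiagonalTorus_eq_diagonal t)).2
    rw [Fin.prod_univ_three] at h
    exact h
  set c0 : Circle := ⟨((t : Matrix.specialUnitaryGroup (Fin 3) ℂ) : Matrix (Fin 3) (Fin 3) ℂ) 0 0,
    mem_sphere_zero_iff_norm.mpr (hd1 0)⟩ with hc0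
  set c1 : Circle := ⟨((t : Matrix.specialUnitaryGroup (Fin 3) ℂ) : Matrix (Fin 3) (Fin 3) ℂ) 1 1,
    mem_sphere_zero_iff_norm.mpr (hd1 1)⟩ with hc1
  have h2 : ((t : Matrix.specialUnitaryGroup (Fin 3) ℂ) : Matrix (Fin 3) (Fin 3) ℂ) 2 2 = (((c0 * c1)⁻¹ : Circle) : ℂ) := by
    rw [Circle.coe_inv, Circle.coe_mul, hc0, hc1]
    exact eq_inv_of_mul_eq_one_right hprod
  set θ₀ : Fin 2 → ℝ := ![Complex.arg (c0 : ℂ), Complex.arg (c1 : ℂ)] with hθ₀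
  -- `E θ₀ = t`, entry by entry
  have hEθ₀ : ∀ i : Fin 3, (Circle.exp ((![θ₀ 0, θ₀ 1, -(θ₀ 0 + θ₀ 1)] : Fin 3 → ℝ) i) : ℂ) =
      ((t : Matrix.specialUnitaryGroup (Fin 3) ℂ) : Matrix (Fin 3) (Fin 3) ℂ) i i := by
    intro i
    fin_cases i
    · show ((Circle.exp (Complex.arg (c0 : ℂ)) : Circle) : ℂ) = (c0 : ℂ)
      rw [Circle.exp_arg]
    · show ((Circle.exp (Complex.arg (c1 : ℂ)) : Circle) : ℂ) = (c1 : ℂ)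
      rw [Circle.exp_arg]
    · show ((Circle.exp (-(Complex.arg (c0 : ℂ) + Complex.arg (c1 : ℂ))) : Circle) : ℂ) =
        ((t : Matrix.specialUnitaryGroup (Fin 3) ℂ) : Matrix (Fin 3) (Fin 3) ℂ) 2 2
      rw [Circle.exp_neg, Circle.exp_add, Circle.exp_arg, Circle.exp_arg, h2]
  have hEt : E θ₀ = t := specialDiagonalTorus_ext fun i => by rw [hE, hEθ₀]
  -- off the walls
  have hoff : ∀ i j : Fin 3, i ≠ j → ∀ k : ℤ,
      (![θ₀ 0, θ₀ 1, -(θ₀ 0 + θ₀ 1)] : Fin 3 → ℝ) i - (![θ₀ 0, θ₀ 1, -(θ₀ 0 + θ₀ 1)] : Fin 3 → ℝ) j ≠ k * (2 * π) := by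
    intro i j hij k hk
    apply hreg i j hij
    rw [← hEθ₀ i, ← hEθ₀ j]
    congr 1
    exact Circle.exp_eq_exp.mpr ⟨k, by linarith⟩
  -- Algorithm 1: a lattice shift lands in a chamber `C τ`
  obtain ⟨m, τ, hmem⟩ := exists_intMul_add_mem_chamber_su3
    (C := fun τ : Equiv.Perm (Fin 3) => {θ : Fin 2 → ℝ |
      (![θ 0, θ 1, -(θ 0 + θ 1)] : Fin 3 → ℝ) (τ 0) < (![θ 0, θ 1, -(θ 0 + θ 1)] : Fin 3 → ℝ) (τ 1) ∧
        (![θ 0, θ 1, -(θ 0 + θ 1)] : Fin 3 → ℝ) (τ 1) < (![θ 0, θ 1, -(θ 0 + θ 1)] : Fin 3 → ℝ) (τ 2) ∧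
          (![θ 0, θ 1, -(θ 0 + θ 1)] : Fin 3 → ℝ) (τ 2) < (![θ 0, θ 1, -(θ 0 + θ 1)] : Fin 3 → ℝ) (τ 0) + 2 * π})
    (fun _ _ => Iff.rfl) hoff
  set θ₁ : Fin 2 → ℝ := (fun k => (m k : ℝ) * (2 * π)) + θ₀ with hθ₁
  -- move the chamber to the alcove with `L_τ`
  set θ : Fin 2 → ℝ := ![(![θ₁ 0, θ₁ 1, -(θ₁ 0 + θ₁ 1)] : Fin 3 → ℝ) (τ 0),
    (![θ₁ 0, θ₁ 1, -(θ₁ 0 + θ₁ 1)] : Fin 3 → ℝ) (τ 1)] with hθ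
  have hθA : θ ∈ {θ : Fin 2 → ℝ |
      (![θ 0, θ 1, -(θ 0 + θ 1)] : Fin 3 → ℝ) ((1 : Equiv.Perm (Fin 3)) 0) <
        (![θ 0, θ 1, -(θ 0 + θ 1)] : Fin 3 → ℝ) ((1 : Equiv.Perm (Fin 3)) 1) ∧
      (![θ 0, θ 1, -(θ 0 + θ 1)] : Fin 3 → ℝ) ((1 : Equiv.Perm (Fin 3)) 1) <
        (![θ 0, θ 1, -(θ 0 + θ 1)] : Fin 3 → ℝ) ((1 : Equiv.Perm (Fin 3)) 2) ∧
      (![θ 0, θ 1, -(θ 0 + θ 1)] : Fin 3 → ℝ) ((1 : Equiv.Perm (Fin 3)) 2) <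
        (![θ 0, θ 1, -(θ 0 + θ 1)] : Fin 3 → ℝ) ((1 : Equiv.Perm (Fin 3)) 0) + 2 * π} := by
    have h := preimage_chamber_perm_su3
      (C := fun τ : Equiv.Perm (Fin 3) => {θ : Fin 2 → ℝ |
        (![θ 0, θ 1, -(θ 0 + θ 1)] : Fin 3 → ℝ) (τ 0) < (![θ 0, θ 1, -(θ 0 + θ 1)] : Fin 3 → ℝ) (τ 1) ∧
          (![θ 0, θ 1, -(θ 0 + θ 1)] : Fin 3 → ℝ) (τ 1) < (![θ 0, θ 1, -(θ 0 + θ 1)] : Fin 3 → ℝ) (τ 2) ∧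
            (![θ 0, θ 1, -(θ 0 + θ 1)] : Fin 3 → ℝ) (τ 2) < (![θ 0, θ 1, -(θ 0 + θ 1)] : Fin 3 → ℝ) (τ 0) + 2 * π})
      (fun _ _ => Iff.rfl) τ 1
    rw [mul_one] at h
    have hθ₁C : θ₁ ∈ (fun θ' : Fin 2 → ℝ =>
        (![(![θ' 0, θ' 1, -(θ' 0 + θ' 1)] : Fin 3 → ℝ) (τ 0), (![θ' 0, θ' 1, -(θ' 0 + θ' 1)] : Fin 3 → ℝ) (τ 1)] :
          Fin 2 → ℝ)) ⁻¹' {θ : Fin 2 → ℝ |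
        (![θ 0, θ 1, -(θ 0 + θ 1)] : Fin 3 → ℝ) ((1 : Equiv.Perm (Fin 3)) 0) <
          (![θ 0, θ 1, -(θ 0 + θ 1)] : Fin 3 → ℝ) ((1 : Equiv.Perm (Fin 3)) 1) ∧
        (![θ 0, θ 1, -(θ 0 + θ 1)] : Fin 3 → ℝ) ((1 : Equiv.Perm (Fin 3)) 1) <
          (![θ 0, θ 1, -(θ 0 + θ 1)] : Fin 3 → ℝ) ((1 : Equiv.Perm (Fin 3)) 2) ∧
        (![θ 0, θ 1, -(θ 0 + θ 1)] : Fin 3 → ℝ) ((1 : Equiv.Perm (Fin 3)) 2) <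
          (![θ 0, θ 1, -(θ 0 + θ 1)] : Fin 3 → ℝ) ((1 : Equiv.Perm (Fin 3)) 0) + 2 * π} := by
      rw [h]
      exact hmem
    exact hθ₁C
  rw [alcove_su3_eq_chamber_one] at hθA
  refine ⟨τ⁻¹, θ, hθA, ?_⟩
  -- `E θ = P τ (E θ₁) = P τ (E θ₀) = P τ t`
  have hEθ : E θ = P τ t := by
    rw [← hEt, ← angleChart_su3_intMul_add hE m θ₀, permDiag_angleChart_su3 hE hP τ]
  rw [hEθ, permDiag_inv_permDiag hP]

end Chart

/-! ## The booked density -/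

section Booked

variable {E : (Fin 2 → ℝ) → specialDiagonalTorus (Fin 3)}
  (hE : ∀ θ (i : Fin 3), (((E θ : specialDiagonalTorus (Fin 3)) : Matrix.specialUnitaryGroup (Fin 3) ℂ) :
    Matrix (Fin 3) (Fin 3) ℂ) i i = (Circle.exp ((![θ 0, θ 1, -(θ 0 + θ 1)] : Fin 3 → ℝ) i) : ℂ))
  {P : Equiv.Perm (Fin 3) → specialDiagonalTorus (Fin 3) → specialDiagonalTorus (Fin 3)}
  (hP : ∀ σ t i,
    (((P σ t : specialDiagonalTorus (Fin 3)) : Matrix.specialUnitaryGroup (Fin 3) ℂ) : Matrix (Fin 3) (Fin 3) ℂ) i i =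
      ((t : Matrix.specialUnitaryGroup (Fin 3) ℂ) : Matrix (Fin 3) (Fin 3) ℂ) (σ i) (σ i))

include hE hP

/-- **The booked torus density of the `SU(3)` spectral kernel.**  Let `f` be continuous on the
unimodular torus, permutation-equivariant, and given on the alcove `A = {θ₀ < θ₁ < −θ₀−θ₁ < θ₀ + 2π}`
by a map `G` sending `A` into `A` (`f(e^{i x(θ)}) = e^{i x(Gθ)}`), with torus map `fT`; let
`J : SU(3) → ℝ≥0∞` be a symmetric function `JD` (measurable) of the spectrum
(`J(V diag(d) V⋆) = JD(d)`) which on the alcove chart is the booked one: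
`JD(e^{i x(θ)}) · |Δ(e^{i x(θ)})|²/3! = JA(θ) · |Δ(e^{i x(Gθ)})|²/3!` (the engine's
`exp(ld_cell + log_haar(x') − log_haar(x))`).  Then a measurable, Weyl-invariant torus density `Jf`
with `Jf ∘ E = JA` on the alcove EXISTS for which Boyda's identity
`J(g t g⁻¹) · |Δ(t)|²/3! = Jf(t) · |Δ(fT t)|²/3!` holds for ALL `g ∈ SU(3)`, `t ∈ SΔ(3)` (at a
degenerate spectrum both Vandermonde factors vanish; a regular `t` is `P σ (E θ)`, `θ ∈ A`) — the
three bookkeeping hypotheses of `hasJacobian_spectralKernel_su3_of_alcoveMap`, discharged. -/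
theorem exists_torusDensity_su3_booked
    {f : (Fin 3 → ℂ) → (Fin 3 → ℂ)} (hfm : Measurable f)
    (hfperm : ∀ (σ : Equiv.Perm (Fin 3)) (d : Fin 3 → ℂ), (∀ i, ‖d i‖ = 1) →
      f (fun i => d (σ i)) = fun i => f d (σ i))
    {G : (Fin 2 → ℝ) → (Fin 2 → ℝ)} {JA : (Fin 2 → ℝ) → ℝ≥0∞}
    (hGA : ∀ θ : Fin 2 → ℝ, θ 0 < θ 1 → θ 1 < -(θ 0 + θ 1) → -(θ 0 + θ 1) < θ 0 + 2 * π →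
      (G θ) 0 < (G θ) 1 ∧ (G θ) 1 < -((G θ) 0 + (G θ) 1) ∧ -((G θ) 0 + (G θ) 1) < (G θ) 0 + 2 * π)
    (hfG : ∀ θ : Fin 2 → ℝ, θ 0 < θ 1 → θ 1 < -(θ 0 + θ 1) → -(θ 0 + θ 1) < θ 0 + 2 * π →
      f (fun i => (Circle.exp ((![θ 0, θ 1, -(θ 0 + θ 1)] : Fin 3 → ℝ) i) : ℂ)) =
        fun i => (Circle.exp ((![(G θ) 0, (G θ) 1, -((G θ) 0 + (G θ) 1)] : Fin 3 → ℝ) i) : ℂ))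
    {fT : specialDiagonalTorus (Fin 3) → specialDiagonalTorus (Fin 3)}
    (hfT : ∀ t : specialDiagonalTorus (Fin 3),
      ((fT t : Matrix.specialUnitaryGroup (Fin 3) ℂ) : Matrix (Fin 3) (Fin 3) ℂ) =
        diagonal (f fun i => ((t : Matrix.specialUnitaryGroup (Fin 3) ℂ) : Matrix (Fin 3) (Fin 3) ℂ) i i))
    {JD : (Fin 3 → ℂ) → ℝ≥0∞} (hJDm : Measurable JD)
    (hJDperm : ∀ (σ : Equiv.Perm (Fin 3)) (d : Fin 3 → ℂ), JD (fun i => d (σ i)) = JD d)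
    (hJchart : ∀ θ : Fin 2 → ℝ, θ 0 < θ 1 → θ 1 < -(θ 0 + θ 1) → -(θ 0 + θ 1) < θ 0 + 2 * π →
      JD (fun i => (Circle.exp ((![θ 0, θ 1, -(θ 0 + θ 1)] : Fin 3 → ℝ) i) : ℂ)) * ENNReal.ofReal
          ((∏ i, ∏ k ∈ Finset.univ.erase i,
            ‖(Circle.exp ((![θ 0, θ 1, -(θ 0 + θ 1)] : Fin 3 → ℝ) i) : ℂ) -
              (Circle.exp ((![θ 0, θ 1, -(θ 0 + θ 1)] : Fin 3 → ℝ) k) : ℂ)‖) / (Fintype.card (Fin 3)).factorial) =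
        JA θ * ENNReal.ofReal
          ((∏ i, ∏ k ∈ Finset.univ.erase i,
            ‖(Circle.exp ((![(G θ) 0, (G θ) 1, -((G θ) 0 + (G θ) 1)] : Fin 3 → ℝ) i) : ℂ) -
              (Circle.exp ((![(G θ) 0, (G θ) 1, -((G θ) 0 + (G θ) 1)] : Fin 3 → ℝ) k) : ℂ)‖) /
                (Fintype.card (Fin 3)).factorial))
    {J : Matrix.specialUnitaryGroup (Fin 3) ℂ → ℝ≥0∞}
    (hJspec : ∀ (W : Matrix.specialUnitaryGroup (Fin 3) ℂ) (V : Matrix (Fin 3) (Fin 3) ℂ) (d : Fin 3 → ℂ),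
      V ∈ Matrix.unitaryGroup (Fin 3) ℂ → (W : Matrix (Fin 3) (Fin 3) ℂ) = V * diagonal d * star V → J W = JD d) :
    ∃ Jf : specialDiagonalTorus (Fin 3) → ℝ≥0∞, Measurable Jf ∧
      (∀ θ : Fin 2 → ℝ, θ 0 < θ 1 → θ 1 < -(θ 0 + θ 1) → -(θ 0 + θ 1) < θ 0 + 2 * π → Jf (E θ) = JA θ) ∧
      (∀ σ t, Jf (P σ t) = Jf t) ∧
      ∀ (g : Matrix.specialUnitaryGroup (Fin 3) ℂ) (t : specialDiagonalTorus (Fin 3)),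
        J (g * (t : Matrix.specialUnitaryGroup (Fin 3) ℂ) * g⁻¹) * ENNReal.ofReal
            ((∏ i, ∏ k ∈ Finset.univ.erase i,
              ‖((t : Matrix.specialUnitaryGroup (Fin 3) ℂ) : Matrix (Fin 3) (Fin 3) ℂ) i i -
                ((t : Matrix.specialUnitaryGroup (Fin 3) ℂ) : Matrix (Fin 3) (Fin 3) ℂ) k k‖) / (Fintype.card (Fin 3)).factorial) =
          Jf t * ENNReal.ofReal
            ((∏ i, ∏ k ∈ Finset.univ.erase i,
              ‖((fT t : Matrix.specialUnitaryGroup (Fin 3) ℂ) : Matrix (Fin 3) (Fin 3) ℂ) i i -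
                ((fT t : Matrix.specialUnitaryGroup (Fin 3) ℂ) : Matrix (Fin 3) (Fin 3) ℂ) k k‖) / (Fintype.card (Fin 3)).factorial) := by
  -- abbreviations: the entries and the Vandermonde weight
  have hentries_cont : ∀ i : Fin 3, Continuous fun t : specialDiagonalTorus (Fin 3) =>
      ((t : Matrix.specialUnitaryGroup (Fin 3) ℂ) : Matrix (Fin 3) (Fin 3) ℂ) i i := fun i =>
    ((continuous_apply i).comp ((continuous_apply i).comp (continuous_subtype_val.comp continuous_subtype_val)))
  have hent : Measurable fun t : specialDiagonalTorus (Fin 3) => fun i =>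
      ((t : Matrix.specialUnitaryGroup (Fin 3) ℂ) : Matrix (Fin 3) (Fin 3) ℂ) i i :=
    (continuous_pi hentries_cont).measurable
  have hDm : Measurable fun t : specialDiagonalTorus (Fin 3) => ENNReal.ofReal
      ((∏ i, ∏ k ∈ Finset.univ.erase i,
        ‖((t : Matrix.specialUnitaryGroup (Fin 3) ℂ) : Matrix (Fin 3) (Fin 3) ℂ) i i -
          ((t : Matrix.specialUnitaryGroup (Fin 3) ℂ) : Matrix (Fin 3) (Fin 3) ℂ) k k‖) / (Fintype.card (Fin 3)).factorial) :=
    measurable_vandermondeWeight_special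
  have hfTm : Measurable fT := measurable_torusMap_of_measurable hfm hfT
  -- entries of `fT t`, `P σ t`, `E θ`
  have hfTent : ∀ t i, ((fT t : Matrix.specialUnitaryGroup (Fin 3) ℂ) : Matrix (Fin 3) (Fin 3) ℂ) i i =
      f (fun k => ((t : Matrix.specialUnitaryGroup (Fin 3) ℂ) : Matrix (Fin 3) (Fin 3) ℂ) k k) i := by
    intro t i
    rw [hfT, diagonal_apply_eq]
  have hEent : ∀ θ, (fun i => (((E θ : specialDiagonalTorus (Fin 3)) : Matrix.specialUnitaryGroup (Fin 3) ℂ) :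
      Matrix (Fin 3) (Fin 3) ℂ) i i) = fun i => (Circle.exp ((![θ 0, θ 1, -(θ 0 + θ 1)] : Fin 3 → ℝ) i) : ℂ) :=
    fun θ => funext (hE θ)
  have hequiv : ∀ σ t, fT (P σ t) = P σ (fT t) := fun σ t => torusMap_permDiag (hP σ) (hfperm σ) hfT t
  have hcomm : ∀ θ : Fin 2 → ℝ, θ 0 < θ 1 → θ 1 < -(θ 0 + θ 1) → -(θ 0 + θ 1) < θ 0 + 2 * π →
      fT (E θ) = E (G θ) := fun θ h0 h1 h2 => torusMap_angleChart_su3 hE hfT (hfG θ h0 h1 h2)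
  -- the regular chart points have non-vanishing, finite Vandermonde weight
  have hDne : ∀ θ : Fin 2 → ℝ, θ 0 < θ 1 → θ 1 < -(θ 0 + θ 1) → -(θ 0 + θ 1) < θ 0 + 2 * π →
      ENNReal.ofReal ((∏ i, ∏ k ∈ Finset.univ.erase i,
        ‖(Circle.exp ((![θ 0, θ 1, -(θ 0 + θ 1)] : Fin 3 → ℝ) i) : ℂ) -
          (Circle.exp ((![θ 0, θ 1, -(θ 0 + θ 1)] : Fin 3 → ℝ) k) : ℂ)‖) / (Fintype.card (Fin 3)).factorial) ≠ 0 := by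
    intro θ h0 h1 h2
    rw [ENNReal.ofReal_ne_zero_iff]
    refine div_pos (Finset.prod_pos fun i _ => Finset.prod_pos fun k hk => ?_) (by positivity)
    have hne := angleChart_su3_regular hE h0 h1 h2 i k (Finset.ne_of_mem_erase hk).symm
    rw [hE, hE] at hne
    exact norm_pos_iff.mpr (sub_ne_zero.mpr hne)
  -- the torus density: `Jf = J · D / (D ∘ fT)`
  set Jf : specialDiagonalTorus (Fin 3) → ℝ≥0∞ := fun t =>
    JD (fun i => ((t : Matrix.specialUnitaryGroup (Fin 3) ℂ) : Matrix (Fin 3) (Fin 3) ℂ) i i) *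
      ENNReal.ofReal ((∏ i, ∏ k ∈ Finset.univ.erase i,
        ‖((t : Matrix.specialUnitaryGroup (Fin 3) ℂ) : Matrix (Fin 3) (Fin 3) ℂ) i i -
          ((t : Matrix.specialUnitaryGroup (Fin 3) ℂ) : Matrix (Fin 3) (Fin 3) ℂ) k k‖) / (Fintype.card (Fin 3)).factorial) /
      ENNReal.ofReal ((∏ i, ∏ k ∈ Finset.univ.erase i,
        ‖((fT t : Matrix.specialUnitaryGroup (Fin 3) ℂ) : Matrix (Fin 3) (Fin 3) ℂ) i i -
          ((fT t : Matrix.specialUnitaryGroup (Fin 3) ℂ) : Matrix (Fin 3) (Fin 3) ℂ) k k‖) / (Fintype.card (Fin 3)).factorial)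
    with hJf
  have hJfm : Measurable Jf := ((hJDm.comp hent).mul hDm).div (hDm.comp hfTm)
  -- `Jf ∘ E = JA` on the alcove
  have hJA : ∀ θ : Fin 2 → ℝ, θ 0 < θ 1 → θ 1 < -(θ 0 + θ 1) → -(θ 0 + θ 1) < θ 0 + 2 * π →
      Jf (E θ) = JA θ := by
    intro θ h0 h1 h2
    obtain ⟨g0, g1, g2⟩ := hGA θ h0 h1 h2
    simp only [hJf]
    rw [hcomm θ h0 h1 h2]
    simp only [hE]
    rw [hJchart θ h0 h1 h2]
    exact ENNReal.mul_div_cancel_right (hDne (G θ) g0 g1 g2) ENNReal.ofReal_ne_top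
  -- `Jf` is Weyl invariant
  have hJinv : ∀ σ t, Jf (P σ t) = Jf t := by
    intro σ t
    simp only [hJf]
    have hPent : (fun i => (((P σ t : specialDiagonalTorus (Fin 3)) : Matrix.specialUnitaryGroup (Fin 3) ℂ) :
        Matrix (Fin 3) (Fin 3) ℂ) i i) = fun i => ((t : Matrix.specialUnitaryGroup (Fin 3) ℂ) : Matrix (Fin 3) (Fin 3) ℂ) (σ i) (σ i) :=
      funext (hP σ t)
    rw [hPent, hJDperm σ (fun k => ((t : Matrix.specialUnitaryGroup (Fin 3) ℂ) : Matrix (Fin 3) (Fin 3) ℂ) k k), hequiv]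
    simp only [hP]
    rw [vandermondeProd_perm σ (fun i => ((t : Matrix.specialUnitaryGroup (Fin 3) ℂ) : Matrix (Fin 3) (Fin 3) ℂ) i i),
      vandermondeProd_perm σ (fun i => ((fT t : Matrix.specialUnitaryGroup (Fin 3) ℂ) : Matrix (Fin 3) (Fin 3) ℂ) i i)]
  -- Boyda's identity: at regular `t = P σ (E θ)` by construction, at degenerate `t` both sides vanish
  have hJ : ∀ (g : Matrix.specialUnitaryGroup (Fin 3) ℂ) (t : specialDiagonalTorus (Fin 3)),
      J (g * (t : Matrix.specialUnitaryGroup (Fin 3) ℂ) * g⁻¹) * ENNReal.ofReal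
          ((∏ i, ∏ k ∈ Finset.univ.erase i,
            ‖((t : Matrix.specialUnitaryGroup (Fin 3) ℂ) : Matrix (Fin 3) (Fin 3) ℂ) i i -
              ((t : Matrix.specialUnitaryGroup (Fin 3) ℂ) : Matrix (Fin 3) (Fin 3) ℂ) k k‖) / (Fintype.card (Fin 3)).factorial) =
        Jf t * ENNReal.ofReal
          ((∏ i, ∏ k ∈ Finset.univ.erase i,
            ‖((fT t : Matrix.specialUnitaryGroup (Fin 3) ℂ) : Matrix (Fin 3) (Fin 3) ℂ) i i -
              ((fT t : Matrix.specialUnitaryGroup (Fin 3) ℂ) : Matrix (Fin 3) (Fin 3) ℂ) k k‖) / (Fintype.card (Fin 3)).factorial) := by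
    intro g t
    by_cases hr : ∃ i j, i ≠ j ∧ ((t : Matrix.specialUnitaryGroup (Fin 3) ℂ) : Matrix (Fin 3) (Fin 3) ℂ) i i =
        ((t : Matrix.specialUnitaryGroup (Fin 3) ℂ) : Matrix (Fin 3) (Fin 3) ℂ) j j
    · -- degenerate spectrum: both Vandermonde weights vanish (ties of `d` are ties of `f d`)
      obtain ⟨i, j, hij, hd⟩ := hr
      have hfd : ((fT t : Matrix.specialUnitaryGroup (Fin 3) ℂ) : Matrix (Fin 3) (Fin 3) ℂ) i i =
          ((fT t : Matrix.specialUnitaryGroup (Fin 3) ℂ) : Matrix (Fin 3) (Fin 3) ℂ) j j := by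
        rw [hfTent, hfTent]
        set d : Fin 3 → ℂ := fun k => ((t : Matrix.specialUnitaryGroup (Fin 3) ℂ) : Matrix (Fin 3) (Fin 3) ℂ) k k with hdd
        have hswap : (fun k => d (Equiv.swap i j k)) = d := by
          funext k
          by_cases hki : k = i
          · rw [hki, Equiv.swap_apply_left]; exact hd.symm
          · by_cases hkj : k = j
            · rw [hkj, Equiv.swap_apply_right]; exact hd
            · rw [Equiv.swap_apply_of_ne_of_ne hki hkj]
        have key := hfperm (Equiv.swap i j) d (norm_specialDiagonalTorus_apply t)
        rw [hswap] at key
        have hi := congr_fun key i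
        simpa only [Equiv.swap_apply_left] using hi
      rw [vandermondeWeight_eq_zero_of_tie hij hd, vandermondeWeight_eq_zero_of_tie hij hfd, ENNReal.ofReal_zero,
        mul_zero, mul_zero]
    · -- regular spectrum: `t = P σ (E θ)` with `θ` in the alcove
      push Not at hr
      obtain ⟨σ, θ, ⟨h0, h1, h2⟩, rfl⟩ := exists_permDiag_angleChart_of_regular_su3 hE hP (fun i j hij => hr i j hij)
      have hgU : ((g : Matrix.specialUnitaryGroup (Fin 3) ℂ) : Matrix (Fin 3) (Fin 3) ℂ) ∈ Matrix.unitaryGroup (Fin 3) ℂ :=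
        (Matrix.mem_specialUnitaryGroup_iff.mp g.2).1
      have hmul : ∀ A B : Matrix.specialUnitaryGroup (Fin 3) ℂ,
          ((A * B : Matrix.specialUnitaryGroup (Fin 3) ℂ) : Matrix (Fin 3) (Fin 3) ℂ) =
            (A : Matrix (Fin 3) (Fin 3) ℂ) * (B : Matrix (Fin 3) (Fin 3) ℂ) := fun _ _ => rfl
      have hinv : ∀ A : Matrix.specialUnitaryGroup (Fin 3) ℂ,
          ((A⁻¹ : Matrix.specialUnitaryGroup (Fin 3) ℂ) : Matrix (Fin 3) (Fin 3) ℂ) = star (A : Matrix (Fin 3) (Fin 3) ℂ) :=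
        fun _ => rfl
      have hW : ((g * ((P σ (E θ) : specialDiagonalTorus (Fin 3)) : Matrix.specialUnitaryGroup (Fin 3) ℂ) * g⁻¹ :
          Matrix.specialUnitaryGroup (Fin 3) ℂ) : Matrix (Fin 3) (Fin 3) ℂ) =
          (g : Matrix (Fin 3) (Fin 3) ℂ) * diagonal (fun i => (((P σ (E θ) : specialDiagonalTorus (Fin 3)) :
            Matrix.specialUnitaryGroup (Fin 3) ℂ) : Matrix (Fin 3) (Fin 3) ℂ) i i) * star (g : Matrix (Fin 3) (Fin 3) ℂ) := by
        rw [hmul, hmul, hinv, ← coe_specialDiagonalTorus_eq_diagonal]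
      have hPent : (fun i => (((P σ (E θ) : specialDiagonalTorus (Fin 3)) : Matrix.specialUnitaryGroup (Fin 3) ℂ) :
          Matrix (Fin 3) (Fin 3) ℂ) i i) = fun i => (Circle.exp ((![θ 0, θ 1, -(θ 0 + θ 1)] : Fin 3 → ℝ) (σ i)) : ℂ) :=
        funext fun i => by rw [hP, hE]
      rw [hJspec _ _ _ hgU hW, hPent, hJDperm σ (fun i => (Circle.exp ((![θ 0, θ 1, -(θ 0 + θ 1)] : Fin 3 → ℝ) i) : ℂ)),
        hJinv, hequiv, hJA θ h0 h1 h2, hcomm θ h0 h1 h2]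
      simp only [hP, hE]
      rw [vandermondeProd_perm σ (fun i => (Circle.exp ((![θ 0, θ 1, -(θ 0 + θ 1)] : Fin 3 → ℝ) i) : ℂ)),
        vandermondeProd_perm σ (fun i => (Circle.exp ((![(G θ) 0, (G θ) 1, -((G θ) 0 + (G θ) 1)] : Fin 3 → ℝ) i) : ℂ))]
      exact hJchart θ h0 h1 h2
  exact ⟨Jf, hJfm, hJA, hJinv, hJ⟩

end Booked

end Summit.Ventures.LatticeQCDFlow.Exactness
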